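import Summits.QuantumFields.YangMills.Theorems.BalabanUVNodesN08AlphaInB42Sel

/-!
# Route «BalabanUVNodes», Track-A DAG node N08 = [Balaban1985UV3] — THE (α) CLAUSE: existence of the (42)-minimiser BY COMPACTNESS of [7]'s
# closed regular class, so the in-edge conclusion (b11) shrinks to NON-EMPTINESS of the constraint space (8)

Cell `pub-ymgap`, seat `pub-ymgap-dag-n08-d` gen 4, file 6 (director-ym R134 row «CLASS-I in-edge conclusions at the (α) granularity of `RunAlpha`»).
`bears_on: R4∕N08`; filed `--supports stmt-QuantumFields-19903 --as helper`.  Sorry-free, standard axioms.  Refines this seat's file 3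
(`BalabanUVNodesN08AlphaInB42Sel.exists_externalInputs_faces₃`: `InEdgeFaces₃` from (b7) continuity + (b11) «(42) HAS a minimiser in the class»).

THE POINT ([7] p. 279: «there exists a minimal orbit in the space U_k({Ω_j}, B₃ε₁) ∩ 𝔅_k(𝔅_k, V)» — existence is COMPACTNESS).  Run the selection
inside the CLOSED regular class `regClassC 𝔊 𝔠 k h` ([7] (2) with `≤` at HALF the constant; inside file 2's open `regClass`, contains `1`): the
constraint space `admB42c … V` is closed in the compact configuration space (the constraint maps being continuous on the open class, (b7)), so a
minimiser of the continuous objective EXISTS AS SOON AS THE SPACE IS NON-EMPTY (`exists_selector_admB42c` (iii)).  Hence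
★ `exists_externalInputs_faces₃_of_nonempty`: `InEdgeFaces₃ 𝔊 𝔠 X` for minimiser-selected external inputs from (b7) and (b11′) `hne` — for `k ≤ K`,
admissible `h`, every `V`, the space `admB42c … V` is NON-EMPTY (a configuration of the closed class with the prescribed block averages exists: the
kinematic content of [7] Thm 1 (8), no variational content).
HONEST FRAMING: (b7), (b11′) DISPLAYED; nothing of [B10] ∕ [7] ∕ [4] asserted; count-neutral; NOT a discharge of N08.  d = 3 lattice gauge theory on finite
tori as printed; nothing about d = 4, the continuum, OS axioms, a mass gap or the Clay problem.
-/

noncomputable section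

namespace Summit.QuantumFields.YangMills.Theorems.BalabanUVNodesN08AlphaCompactSel

open MeasureTheory Set Topology TopologicalSpace
open scoped Matrix Matrix.Norms.L2Operator
open Literature.MeasureTheory.RandomSets
open Literature.MathematicalPhysics.QuantumFieldTheory.Balaban1983to89
open Literature.MathematicalPhysics.QuantumFieldTheory.Balaban1983to89.B10 (pFun)
open Literature.MathematicalPhysics.QuantumFieldTheory.Balaban1985CMP102.Setting
open Summit.QuantumFields.Balaban3D.Carriers
open Summit.QuantumFields.Balaban3D.Proofs.Primitives (AlphaConsts)
open Summit.QuantumFields.Balaban3D.Proofs.LiftBridge (liftCfg)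
open Summit.QuantumFields.Balaban3D.Proofs.TorusLift (projSite)
open Summit.QuantumFields.Balaban3D.Proofs.ScalesArithmetic (gk_pos gk_le_one)
open Summit.QuantumFields.YangMills.Theorems.BalabanUVNodesN08AlphaClassI (RegLift InB42Lift HLarge)
open Summit.QuantumFields.YangMills.Theorems.BalabanUVNodesN08AlphaLoop28 (InEdgeFaces₃)
open Summit.QuantumFields.YangMills.Theorems.BalabanUVNodesN08AlphaGroupTopology
open Summit.QuantumFields.YangMills.Theorems.BalabanUVNodesN08AlphaMeasUk
open Summit.QuantumFields.YangMills.Theorems.BalabanUVNodesN08AlphaRegSel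
open Summit.QuantumFields.YangMills.Theorems.BalabanUVNodesN08AlphaInB42Sel
open B7Prop1Explicit (e)
open B7Prop2Explicit (avgIter)
variable {L : ℕ}

/-! ## §1 The closed regular class (half constant, `≤`): closed, inside the open class, contains `1` -/

section Closed
variable {S : Scales L} {G : Type} [GaugeGroup G] [MeasurableSpace G] (𝔊 : GroupModel G) (𝔠 : AlphaConsts L 𝔊.N)

/-- **[7]'S REGULAR CLASS READ WITH `≤` AT HALF THE CONSTANT**: all torus plaquette variables with a corner condition in `Ω_j(h)`, `j < k`, within
`½·C68·g_jp(g_j)·L^{−2j}` of `1` — a CLOSED set of configurations inside file 2's open class `regClass 𝔊 𝔠 k h` (the space of [7] (8), «U_k({Ω_j}, B₃ε₁)»,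
read so that compactness is available). [cite: Balaban1985Variational, (2)+(8) pp.278–279] -/
def regClassC (k : ℕ) (h : Hist S.P k) : Set (GaugeField S.P 0 G) :=
  {U | ∀ j < k, ∀ (y : Site S.P 0) (μ ν : Fin S.P.d), μ ≠ ν →
    (y ∈ Omega 𝔠.lane.carrier.M₁ (rcolOf S 𝔠.lane.carrier) k h j ∨ y.shift μ ∈ Omega 𝔠.lane.carrier.M₁ (rcolOf S 𝔠.lane.carrier) k h j ∨
      y.shift ν ∈ Omega 𝔠.lane.carrier.M₁ (rcolOf S 𝔠.lane.carrier) k h j ∨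
      (y.shift μ).shift ν ∈ Omega 𝔠.lane.carrier.M₁ (rcolOf S 𝔠.lane.carrier) k h j) →
    dist1 (plaqVar U y μ ν) ≤ 𝔠.C68 / 2 * (S.gk j * pFun 𝔠.lane.carrier.b₀ 𝔠.lane.carrier.p₀ (S.gk j)) * (((L : ℝ) ^ j)⁻¹) ^ 2}

/-- The regularity constants are positive on the run's scales `j ≤ K`. [folklore] -/
theorem regConst_pos {j : ℕ} (hj : j ≤ S.K) : 0 < 𝔠.C68 * (S.gk j * pFun 𝔠.lane.carrier.b₀ 𝔠.lane.carrier.p₀ (S.gk j)) := by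
  have hg0 : 0 < S.gk j := gk_pos S j
  have hg1 : S.gk j ≤ 1 := gk_le_one S S.gK_le_one j hj
  have hp : 0 < pFun 𝔠.lane.carrier.b₀ 𝔠.lane.carrier.p₀ (S.gk j) :=
    Summit.QuantumFields.Balaban3D.Proofs.CouplingWindow.pFun_pos _ _ _ (show 0 < 𝔠.b₀ from 𝔠.b₀_pos) hg0 hg1
  exact mul_pos 𝔠.C68_pos (mul_pos hg0 hp)

/-- **The closed class lies inside the open class** (`≤ ½c < c`, on the run's scales). [cite: Balaban1985Variational, (2) p.278] -/
theorem regClassC_subset_regClass {k : ℕ} (hk : k ≤ S.K) (h : Hist S.P k) : regClassC 𝔊 𝔠 k h ⊆ regClass 𝔊 𝔠 k h := by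
  intro U hU j hj
  rw [regLift_liftCfg_iff]
  intro y μ ν hμν hcor
  have hc := regConst_pos 𝔊 𝔠 (show j ≤ S.K by omega)
  have hLj : 0 < (((L : ℝ) ^ j)⁻¹) ^ 2 := by
    have := 𝔠.one_lt_L
    positivity
  refine (hU j hj y μ ν hμν hcor).trans_lt ?_
  nlinarith

/-- The closed class is CLOSED in the topology of the realisation (finitely many non-strict inequalities on continuous functions). [cite: Balaban1985Variational, (2) p.278] -/
theorem isClosed_regClassC (k : ℕ) (h : Hist S.P k) : letI := rhoTopology 𝔊; IsClosed (regClassC 𝔊 𝔠 k h) := by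
  letI := rhoTopology 𝔊
  have hset : regClassC 𝔊 𝔠 k h = ⋂ j ∈ Finset.range k, ⋂ (y : Site S.P 0), ⋂ (μ : Fin S.P.d), ⋂ (ν : Fin S.P.d),
      {U : GaugeField S.P 0 G | μ ≠ ν →
        (y ∈ Omega 𝔠.lane.carrier.M₁ (rcolOf S 𝔠.lane.carrier) k h j ∨ y.shift μ ∈ Omega 𝔠.lane.carrier.M₁ (rcolOf S 𝔠.lane.carrier) k h j ∨
          y.shift ν ∈ Omega 𝔠.lane.carrier.M₁ (rcolOf S 𝔠.lane.carrier) k h j ∨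
          (y.shift μ).shift ν ∈ Omega 𝔠.lane.carrier.M₁ (rcolOf S 𝔠.lane.carrier) k h j) →
        dist1 (plaqVar U y μ ν) ≤ 𝔠.C68 / 2 * (S.gk j * pFun 𝔠.lane.carrier.b₀ 𝔠.lane.carrier.p₀ (S.gk j)) * (((L : ℝ) ^ j)⁻¹) ^ 2} := by
    ext U
    simp only [regClassC, mem_setOf_eq, mem_iInter, Finset.mem_range]
  rw [hset]
  refine isClosed_biInter fun j _ => isClosed_iInter fun y => isClosed_iInter fun μ => isClosed_iInter fun ν => ?_
  by_cases hp : μ ≠ ν ∧ (y ∈ Omega 𝔠.lane.carrier.M₁ (rcolOf S 𝔠.lane.carrier) k h j ∨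
      y.shift μ ∈ Omega 𝔠.lane.carrier.M₁ (rcolOf S 𝔠.lane.carrier) k h j ∨ y.shift ν ∈ Omega 𝔠.lane.carrier.M₁ (rcolOf S 𝔠.lane.carrier) k h j ∨
      (y.shift μ).shift ν ∈ Omega 𝔠.lane.carrier.M₁ (rcolOf S 𝔠.lane.carrier) k h j)
  · have h2 : {U : GaugeField S.P 0 G | μ ≠ ν →
        (y ∈ Omega 𝔠.lane.carrier.M₁ (rcolOf S 𝔠.lane.carrier) k h j ∨ y.shift μ ∈ Omega 𝔠.lane.carrier.M₁ (rcolOf S 𝔠.lane.carrier) k h j ∨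
          y.shift ν ∈ Omega 𝔠.lane.carrier.M₁ (rcolOf S 𝔠.lane.carrier) k h j ∨
          (y.shift μ).shift ν ∈ Omega 𝔠.lane.carrier.M₁ (rcolOf S 𝔠.lane.carrier) k h j) →
        dist1 (plaqVar U y μ ν) ≤ 𝔠.C68 / 2 * (S.gk j * pFun 𝔠.lane.carrier.b₀ 𝔠.lane.carrier.p₀ (S.gk j)) * (((L : ℝ) ^ j)⁻¹) ^ 2} =
        {U | dist1 (plaqVar U y μ ν) ≤ 𝔠.C68 / 2 * (S.gk j * pFun 𝔠.lane.carrier.b₀ 𝔠.lane.carrier.p₀ (S.gk j)) * (((L : ℝ) ^ j)⁻¹) ^ 2} := by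
      ext U
      simp only [mem_setOf_eq]
      exact ⟨fun h' => h' hp.1 hp.2, fun h' _ _ => h'⟩
    rw [h2]
    exact isClosed_le ((continuous_dist1_rho 𝔊).comp (continuous_plaqVar 𝔊 y μ ν)) continuous_const
  · have h2 : {U : GaugeField S.P 0 G | μ ≠ ν →
        (y ∈ Omega 𝔠.lane.carrier.M₁ (rcolOf S 𝔠.lane.carrier) k h j ∨ y.shift μ ∈ Omega 𝔠.lane.carrier.M₁ (rcolOf S 𝔠.lane.carrier) k h j ∨
          y.shift ν ∈ Omega 𝔠.lane.carrier.M₁ (rcolOf S 𝔠.lane.carrier) k h j ∨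
          (y.shift μ).shift ν ∈ Omega 𝔠.lane.carrier.M₁ (rcolOf S 𝔠.lane.carrier) k h j) →
        dist1 (plaqVar U y μ ν) ≤ 𝔠.C68 / 2 * (S.gk j * pFun 𝔠.lane.carrier.b₀ 𝔠.lane.carrier.p₀ (S.gk j)) * (((L : ℝ) ^ j)⁻¹) ^ 2} = Set.univ := by
      ext U
      simp only [mem_setOf_eq, mem_univ, iff_true]
      exact fun h1 h2' => absurd ⟨h1, h2'⟩ hp
    rw [h2]
    exact isClosed_univ

/-- The unit configuration lies in the closed class (on the run's scales). [cite: Balaban1985Variational, (2) p.278] -/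
theorem one_mem_regClassC {k : ℕ} (hk : k ≤ S.K) (h : Hist S.P k) : (1 : GaugeField S.P 0 G) ∈ regClassC 𝔊 𝔠 k h := by
  intro j hj y μ ν _ _
  rw [plaqVar_one, GaugeGroup.dist1_one]
  have hc := regConst_pos 𝔊 𝔠 (show j ≤ S.K by omega)
  have hLj : 0 ≤ (((L : ℝ) ^ j)⁻¹) ^ 2 := by positivity
  have : 0 ≤ 𝔠.C68 / 2 * (S.gk j * pFun 𝔠.lane.carrier.b₀ 𝔠.lane.carrier.p₀ (S.gk j)) := by nlinarith
  exact mul_nonneg this hLj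
end Closed

/-! ## §2 The (42)-constraint space inside the closed class: closed, compact, minimisers by compactness, measurable selectors -/

section Problem
variable {S : Scales L} {G : Type} [GaugeGroup G] [MeasurableSpace G] (𝔊 : GroupModel G) (𝔠 : AlphaConsts L 𝔊.N)

/-- **THE (42)-CONSTRAINT SPACE OF [7] (8) IN THE CLOSED CLASS**: file 3's `admB42` intersected with the closed regular class — configurations of the
open class AND of the closed class whose lifted `j`-fold averages agree with `(Vl)_j` on the bonds of `Λ_j(h)`, `j < k`, with the guarded top clause.
[cite: Balaban1985UV3, (42) p.266; Balaban1985Variational, (3)+(6)+(8) pp.278–279] -/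
def admB42c (k : ℕ) (h : Hist S.P k) (Vl : ℕ → B7Prop1Explicit.Site S.P.d → Fin S.P.d → (Matrix (Fin 𝔊.N) (Fin 𝔊.N) ℂ)ˣ)
    (Sm : Set (GaugeField S.P k G)) (T : GaugeField S.P 0 G → GaugeField S.P k G) (Bk : Set (PBond S.P k)) (V : GaugeField S.P k G) :
    Set (GaugeField S.P 0 G) :=
  admB42 𝔊 𝔠 k h Vl Sm T Bk V ∩ regClassC 𝔊 𝔠 k h

/-- **THE CONSTRAINT SPACE IN THE CLOSED CLASS: MEASURABLE SELECTORS, AND MINIMISERS BY COMPACTNESS.**  Given (b7) (the lifted averages at the bonds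
of `Λ_j(h)` and `T` continuous on the open class): (i)–(ii) a measurable `f` selecting a minimiser of `A` on `admB42c … V` wherever one exists, `1`
elsewhere (file 3's §1 selection over the open class, the closed class folded into the closed relation through the coordinate `U ↦ U`); (iii) on the
run's scales `k ≤ K` the space `admB42c … V` is CLOSED (closed class ∩ preimage of a closed relation under a map continuous on it,
`ContinuousOn.preimage_isClosed_of_isClosed`) in the compact configuration space, so a minimiser EXISTS AS SOON AS IT IS NON-EMPTY — [7] p. 279 «there
exists a minimal orbit». [cite: Balaban1985UV3, (42) p.266; Balaban1985Variational, Thm 1 (8) p.279 (existence half by compactness; measurable-selection reading)] -/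
theorem exists_selector_admB42c (k : ℕ) (h : Hist S.P k)
    (Vl : ℕ → B7Prop1Explicit.Site S.P.d → Fin S.P.d → (Matrix (Fin 𝔊.N) (Fin 𝔊.N) ℂ)ˣ)
    {Sm : Set (GaugeField S.P k G)} (hSm : letI := rhoTopology 𝔊; IsOpen Sm)
    (T : GaugeField S.P 0 G → GaugeField S.P k G) (Bk : Set (PBond S.P k))
    (hcont : letI := rhoTopology 𝔊; ∀ j < k, ∀ (z : B7Prop1Explicit.Site S.P.d) (κ : Fin S.P.d),
      projSite (((L : ℤ) ^ j) • z) ∈ Lam 𝔠.lane.carrier.M₁ (rcolOf S 𝔠.lane.carrier) h j →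
      projSite (((L : ℤ) ^ j) • (z + e κ)) ∈ Lam 𝔠.lane.carrier.M₁ (rcolOf S 𝔠.lane.carrier) h j →
      ContinuousOn (fun U : GaugeField S.P 0 G => ((avgIter L (liftCfg 𝔊 U) j z κ : (Matrix (Fin 𝔊.N) (Fin 𝔊.N) ℂ)ˣ) :
        Matrix (Fin 𝔊.N) (Fin 𝔊.N) ℂ)) (regClass 𝔊 𝔠 k h))
    (hT : letI := rhoTopology 𝔊; ContinuousOn T (regClass 𝔊 𝔠 k h))
    {A : GaugeField S.P 0 G → ℝ} (hA : letI := rhoTopology 𝔊; Continuous A) :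
    (∃ f : GaugeField S.P k G → GaugeField S.P 0 G, Measurable f ∧
      (∀ V, (∃ U ∈ admB42c 𝔊 𝔠 k h Vl Sm T Bk V, IsMinOn A (admB42c 𝔊 𝔠 k h Vl Sm T Bk V) U) →
        f V ∈ admB42c 𝔊 𝔠 k h Vl Sm T Bk V ∧ IsMinOn A (admB42c 𝔊 𝔠 k h Vl Sm T Bk V) (f V)) ∧
      (∀ V, ¬ (∃ U ∈ admB42c 𝔊 𝔠 k h Vl Sm T Bk V, IsMinOn A (admB42c 𝔊 𝔠 k h Vl Sm T Bk V) U) → f V = 1)) ∧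
    (k ≤ S.K → ∀ V, (admB42c 𝔊 𝔠 k h Vl Sm T Bk V).Nonempty →
      ∃ U ∈ admB42c 𝔊 𝔠 k h Vl Sm T Bk V, IsMinOn A (admB42c 𝔊 𝔠 k h Vl Sm T Bk V) U) := by
  classical
  letI := rhoTopology 𝔊
  haveI := secondCountableTopology_rho 𝔊
  haveI := borelSpace_rho 𝔊
  haveI : T2Space G := (isEmbedding_rho 𝔊).t2Space
  haveI : SecondCountableTopology (GaugeField S.P k G) := inferInstanceAs (SecondCountableTopology (PBond S.P k → G))
  haveI : BorelSpace (GaugeField S.P k G) := inferInstanceAs (BorelSpace (PBond S.P k → G))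
  haveI : SecondCountableTopology (GaugeField S.P 0 G) := inferInstanceAs (SecondCountableTopology (PBond S.P 0 → G))
  haveI : BorelSpace (GaugeField S.P 0 G) := inferInstanceAs (BorelSpace (PBond S.P 0 → G))
  letI : MeasurableSpace (Matrix (Fin 𝔊.N) (Fin 𝔊.N) ℂ) := borel _
  haveI : BorelSpace (Matrix (Fin 𝔊.N) (Fin 𝔊.N) ℂ) := ⟨rfl⟩
  haveI : SecondCountableTopology (Matrix (Fin 𝔊.N) (Fin 𝔊.N) ℂ) := secondCountableTopology_matrix (n := Fin 𝔊.N)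
  haveI : SecondCountableTopology (B7Prop1Explicit.Site S.P.d → Fin S.P.d → Matrix (Fin 𝔊.N) (Fin 𝔊.N) ℂ) := inferInstance
  haveI : SecondCountableTopology (Fin k → B7Prop1Explicit.Site S.P.d → Fin S.P.d → Matrix (Fin 𝔊.N) (Fin 𝔊.N) ℂ) := inferInstance
  haveI : BorelSpace (Fin k → B7Prop1Explicit.Site S.P.d → Fin S.P.d → Matrix (Fin 𝔊.N) (Fin 𝔊.N) ℂ) := inferInstance
  -- pre-synthesised product instances (the nested products exhaust the synthesiser otherwise)
  letI instT1 : TopologicalSpace ((Fin k → B7Prop1Explicit.Site S.P.d → Fin S.P.d → Matrix (Fin 𝔊.N) (Fin 𝔊.N) ℂ) × GaugeField S.P k G) := inferInstance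
  letI instM1 : MeasurableSpace ((Fin k → B7Prop1Explicit.Site S.P.d → Fin S.P.d → Matrix (Fin 𝔊.N) (Fin 𝔊.N) ℂ) × GaugeField S.P k G) := inferInstance
  haveI : OpensMeasurableSpace ((Fin k → B7Prop1Explicit.Site S.P.d → Fin S.P.d → Matrix (Fin 𝔊.N) (Fin 𝔊.N) ℂ) × GaugeField S.P k G) := inferInstance
  haveI : SecondCountableTopology ((Fin k → B7Prop1Explicit.Site S.P.d → Fin S.P.d → Matrix (Fin 𝔊.N) (Fin 𝔊.N) ℂ) × GaugeField S.P k G) :=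
    inferInstance
  letI instT2 : TopologicalSpace (((Fin k → B7Prop1Explicit.Site S.P.d → Fin S.P.d → Matrix (Fin 𝔊.N) (Fin 𝔊.N) ℂ) × GaugeField S.P k G) × GaugeField S.P 0 G) :=
    inferInstance
  letI instM2 : MeasurableSpace (((Fin k → B7Prop1Explicit.Site S.P.d → Fin S.P.d → Matrix (Fin 𝔊.N) (Fin 𝔊.N) ℂ) × GaugeField S.P k G) × GaugeField S.P 0 G) :=
    inferInstance
  haveI : OpensMeasurableSpace (((Fin k → B7Prop1Explicit.Site S.P.d → Fin S.P.d → Matrix (Fin 𝔊.N) (Fin 𝔊.N) ℂ) × GaugeField S.P k G) × GaugeField S.P 0 G) :=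
    inferInstance
  letI : TopologicalSpace ((((Fin k → B7Prop1Explicit.Site S.P.d → Fin S.P.d → Matrix (Fin 𝔊.N) (Fin 𝔊.N) ℂ) × GaugeField S.P k G) ×
      GaugeField S.P 0 G) × (((Fin k → B7Prop1Explicit.Site S.P.d → Fin S.P.d → Matrix (Fin 𝔊.N) (Fin 𝔊.N) ℂ) × GaugeField S.P k G) ×
      GaugeField S.P 0 G)) := inferInstance
  let g : GaugeField S.P 0 G → ((Fin k → B7Prop1Explicit.Site S.P.d → Fin S.P.d → Matrix (Fin 𝔊.N) (Fin 𝔊.N) ℂ) × GaugeField S.P k G) ×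
      GaugeField S.P 0 G :=
    fun U => ((fun j z κ =>
      if projSite (((L : ℤ) ^ (j : ℕ)) • z) ∈ Lam 𝔠.lane.carrier.M₁ (rcolOf S 𝔠.lane.carrier) h j ∧
          projSite (((L : ℤ) ^ (j : ℕ)) • (z + e κ)) ∈ Lam 𝔠.lane.carrier.M₁ (rcolOf S 𝔠.lane.carrier) h j
      then ((avgIter L (liftCfg 𝔊 U) (j : ℕ) z κ : (Matrix (Fin 𝔊.N) (Fin 𝔊.N) ℂ)ˣ) : Matrix (Fin 𝔊.N) (Fin 𝔊.N) ℂ) else 0, T U), U)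
  let π : GaugeField S.P k G → ((Fin k → B7Prop1Explicit.Site S.P.d → Fin S.P.d → Matrix (Fin 𝔊.N) (Fin 𝔊.N) ℂ) × GaugeField S.P k G) ×
      GaugeField S.P 0 G :=
    fun V => ((fun j z κ => ((Vl (j : ℕ) z κ : (Matrix (Fin 𝔊.N) (Fin 𝔊.N) ℂ)ˣ) : Matrix (Fin 𝔊.N) (Fin 𝔊.N) ℂ), V), 1)
  let R₁ : Set ((((Fin k → B7Prop1Explicit.Site S.P.d → Fin S.P.d → Matrix (Fin 𝔊.N) (Fin 𝔊.N) ℂ) × GaugeField S.P k G) ×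
      GaugeField S.P 0 G) × (((Fin k → B7Prop1Explicit.Site S.P.d → Fin S.P.d → Matrix (Fin 𝔊.N) (Fin 𝔊.N) ℂ) × GaugeField S.P k G) ×
      GaugeField S.P 0 G)) :=
    {p | ∀ (j : Fin k) (z : B7Prop1Explicit.Site S.P.d) (κ : Fin S.P.d),
      projSite (((L : ℤ) ^ (j : ℕ)) • z) ∈ Lam 𝔠.lane.carrier.M₁ (rcolOf S 𝔠.lane.carrier) h j →
      projSite (((L : ℤ) ^ (j : ℕ)) • (z + e κ)) ∈ Lam 𝔠.lane.carrier.M₁ (rcolOf S 𝔠.lane.carrier) h j →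
        p.1.1.1 j z κ = p.2.1.1 j z κ}
  let R₂ : Set ((((Fin k → B7Prop1Explicit.Site S.P.d → Fin S.P.d → Matrix (Fin 𝔊.N) (Fin 𝔊.N) ℂ) × GaugeField S.P k G) ×
      GaugeField S.P 0 G) × (((Fin k → B7Prop1Explicit.Site S.P.d → Fin S.P.d → Matrix (Fin 𝔊.N) (Fin 𝔊.N) ℂ) × GaugeField S.P k G) ×
      GaugeField S.P 0 G)) :=
    {p | p.2.1.2 ∈ Sm → ∀ b ∈ Bk, p.1.1.2 b = p.2.1.2 b}
  let R₃ : Set ((((Fin k → B7Prop1Explicit.Site S.P.d → Fin S.P.d → Matrix (Fin 𝔊.N) (Fin 𝔊.N) ℂ) × GaugeField S.P k G) ×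
      GaugeField S.P 0 G) × (((Fin k → B7Prop1Explicit.Site S.P.d → Fin S.P.d → Matrix (Fin 𝔊.N) (Fin 𝔊.N) ℂ) × GaugeField S.P k G) ×
      GaugeField S.P 0 G)) :=
    {p | p.1.2 ∈ regClassC 𝔊 𝔠 k h}
  let R := R₁ ∩ R₂ ∩ R₃
  have hπ : Measurable π := (measurable_const.prodMk measurable_id).prodMk measurable_const
  have hg : ContinuousOn g (regClass 𝔊 𝔠 k h) := by
    refine ContinuousOn.prodMk (ContinuousOn.prodMk ?_ hT) continuousOn_id
    refine continuousOn_pi.mpr fun j => continuousOn_pi.mpr fun z => continuousOn_pi.mpr fun κ => ?_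
    by_cases hc : projSite (((L : ℤ) ^ (j : ℕ)) • z) ∈ Lam 𝔠.lane.carrier.M₁ (rcolOf S 𝔠.lane.carrier) h j ∧
        projSite (((L : ℤ) ^ (j : ℕ)) • (z + e κ)) ∈ Lam 𝔠.lane.carrier.M₁ (rcolOf S 𝔠.lane.carrier) h j
    · simp only [if_pos hc]
      exact hcont j j.2 z κ hc.1 hc.2
    · simp only [if_neg hc]
      exact continuousOn_const
  have hcoordl : ∀ (j : Fin k) (z : B7Prop1Explicit.Site S.P.d) (κ : Fin S.P.d), Continuous fun p :
      ((Fin k → B7Prop1Explicit.Site S.P.d → Fin S.P.d → Matrix (Fin 𝔊.N) (Fin 𝔊.N) ℂ) × GaugeField S.P k G) × GaugeField S.P 0 G => p.1.1 j z κ :=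
    fun j z κ => (continuous_apply κ).comp ((continuous_apply z).comp ((continuous_apply j).comp (continuous_fst.comp continuous_fst)))
  have hcoordk : ∀ b : PBond S.P k, Continuous fun p :
      ((Fin k → B7Prop1Explicit.Site S.P.d → Fin S.P.d → Matrix (Fin 𝔊.N) (Fin 𝔊.N) ℂ) × GaugeField S.P k G) × GaugeField S.P 0 G => p.1.2 b :=
    fun b => (show Continuous fun V : GaugeField S.P k G => V b from continuous_apply b).comp (continuous_snd.comp continuous_fst)
  have hR₁ : IsClosed R₁ := by
    simp only [R₁, setOf_forall]
    refine isClosed_iInter fun j => isClosed_iInter fun z => isClosed_iInter fun κ => isClosed_iInter fun _ => isClosed_iInter fun _ => ?_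
    exact isClosed_eq ((hcoordl j z κ).comp continuous_fst) ((hcoordl j z κ).comp continuous_snd)
  have hR₂ : IsClosed R₂ := by
    have hset : R₂ = {p | p.2.1.2 ∉ Sm} ∪ ⋂ b ∈ Bk, {p | p.1.1.2 b = p.2.1.2 b} := by
      ext p
      simp only [R₂, mem_setOf_eq, mem_union, mem_iInter]
      exact ⟨fun hp => (em (p.2.1.2 ∈ Sm)).elim (fun hs => Or.inr (hp hs)) Or.inl, fun hp hs => hp.elim (fun hn => absurd hs hn) id⟩
    rw [hset]
    refine IsClosed.union ?_ (isClosed_biInter fun b _ => isClosed_eq ((hcoordk b).comp continuous_fst) ((hcoordk b).comp continuous_snd))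
    exact (hSm.isClosed_compl).preimage ((continuous_snd.comp continuous_fst).comp continuous_snd)
  have hR₃ : IsClosed R₃ := (isClosed_regClassC 𝔊 𝔠 k h).preimage (continuous_snd.comp continuous_fst)
  have hR : IsClosed R := (hR₁.inter hR₂).inter hR₃
  have hadm : ∀ (U : GaugeField S.P 0 G) (V : GaugeField S.P k G),
      (U ∈ regClass 𝔊 𝔠 k h ∧ (g U, π V) ∈ R) ↔ U ∈ admB42c 𝔊 𝔠 k h Vl Sm T Bk V := by
    intro U V
    simp only [admB42c, admB42, mem_inter_iff, mem_setOf_eq, R, R₁, R₂, R₃, g, π, InB42Lift]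
    constructor
    · rintro ⟨hU, ⟨hl, hk'⟩, hC'⟩
      refine ⟨⟨hU, fun j hj z κ h1 h2 => ?_, hk'⟩, hC'⟩
      have h' := hl ⟨j, hj⟩ z κ h1 h2
      rw [if_pos ⟨h1, h2⟩] at h'
      exact Units.val_injective h'
    · rintro ⟨⟨hU, hl, hk'⟩, hC'⟩
      refine ⟨hU, ⟨fun j z κ h1 h2 => ?_, hk'⟩, hC'⟩
      rw [if_pos ⟨h1, h2⟩]
      exact congrArg Units.val (hl j j.2 z κ h1 h2)
  obtain ⟨f, hfm, hfin, hfout⟩ :=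
    exists_measurable_constrainedMin_rho_of_continuousOn 𝔊 (i := 0) hπ (isOpen_regClass 𝔊 𝔠 k h) hg hR hA 1
  refine ⟨⟨f, hfm, fun V hV => ?_, fun V hV => ?_⟩, fun hk V hne => ?_⟩
  · obtain ⟨U₀, hU₀, hmin⟩ := hV
    have hex : ∃ U, (U ∈ regClass 𝔊 𝔠 k h ∧ (g U, π V) ∈ R) ∧ ∀ U', U' ∈ regClass 𝔊 𝔠 k h ∧ (g U', π V) ∈ R → A U ≤ A U' :=
      ⟨U₀, (hadm U₀ V).mpr hU₀, fun U' hU' => hmin ((hadm U' V).mp hU')⟩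
    obtain ⟨hf₁, hf₂⟩ := hfin V hex
    exact ⟨(hadm (f V) V).mp hf₁, fun U' hU' => hf₂ U' ((hadm U' V).mpr hU')⟩
  · refine hfout V fun h' => hV ?_
    obtain ⟨U₀, hU₀, hmin⟩ := h'
    exact ⟨U₀, (hadm U₀ V).mp hU₀, fun U' hU' => hmin U' ((hadm U' V).mpr hU')⟩
  · -- (iii) existence by compactness: on the run's scales the space is closed in the compact configuration space
    haveI := compactSpace_rho 𝔊
    haveI : CompactSpace (GaugeField S.P 0 G) := inferInstanceAs (CompactSpace (PBond S.P 0 → G))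
    have hsub : regClassC 𝔊 𝔠 k h ⊆ regClass 𝔊 𝔠 k h := regClassC_subset_regClass 𝔊 𝔠 hk h
    have hRV : IsClosed {z | (z, π V) ∈ R} := hR.preimage (continuous_id.prodMk continuous_const)
    have hcl : IsClosed (regClassC 𝔊 𝔠 k h ∩ g ⁻¹' {z | (z, π V) ∈ R}) :=
      (hg.mono hsub).preimage_isClosed_of_isClosed (isClosed_regClassC 𝔊 𝔠 k h) hRV
    have hset : admB42c 𝔊 𝔠 k h Vl Sm T Bk V = regClassC 𝔊 𝔠 k h ∩ g ⁻¹' {z | (z, π V) ∈ R} := by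
      ext U
      constructor
      · intro hU
        have hC' : U ∈ regClassC 𝔊 𝔠 k h := hU.2
        exact ⟨hC', ((hadm U V).mpr hU).2⟩
      · rintro ⟨hC', hUR⟩
        exact (hadm U V).mp ⟨hsub hC', hUR⟩
    rw [hset] at hne ⊢
    exact hcl.isCompact.exists_isMinOn hne hA.continuousOn
end Problem

/-! ## §3 `InEdgeFaces₃` from (b7) continuity and (b11′) NON-EMPTINESS of the constraint space -/

section Faces
variable {S : Scales L} {G : Type} [GaugeGroup G] [MeasurableSpace G] [HaarData G] (𝔊 : GroupModel G) (𝔠 : AlphaConsts L 𝔊.N)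

/-- **★ `InEdgeFaces₃` FROM (b7) AND NON-EMPTINESS.**  As file 3's `exists_externalInputs_faces₃`, with the variational hypothesis (b11) «(42) HAS a
minimiser in the class» REPLACED by (b11′) `hne`: for `k ≤ K`, admissible `h` and every `V`, the constraint space `admB42c … V` of [7] (8) inside the
CLOSED regular class is NON-EMPTY — the minimiser then EXISTS by compactness (`exists_isMinOn_admB42c`).  Conclusion: external inputs `X` (same `av`,
`reg` as `X₀`) whose `U_k(·, h)` are measurable minimiser selections with (i) `measUk` for all `k, h`, (ii) `reg2` for all `k ≤ K`, (iii) at admissible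
histories the value IS a minimiser in the constraint space, (iv) `InEdgeFaces₃ 𝔊 𝔠 X`.
[cite: Balaban1985UV3, (42) p.266 + (67)–(68) p.273; Balaban1985Variational, (2)+(3)+(8) pp.278–279, Thm 1 p.279 (existence half by compactness); Balaban1985Averaging, (42)–(43) pp.23–24] -/
theorem exists_externalInputs_faces₃_of_nonempty (X₀ : ExternalInputs S G) {A : GaugeField S.P 0 G → ℝ}
    (hA : letI := rhoTopology 𝔊; Continuous A)
    (Vl : (k : ℕ) → Hist S.P k → ℕ → B7Prop1Explicit.Site S.P.d → Fin S.P.d → (Matrix (Fin 𝔊.N) (Fin 𝔊.N) ℂ)ˣ)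
    (hVl : ∀ (k : ℕ) (h : Hist S.P k), HLarge S 𝔠.lane.carrier.b₀ 𝔠.lane.carrier.p₀ h (Vl k h))
    (Sm : (k : ℕ) → Hist S.P k → Set (GaugeField S.P k G)) (hSm : letI := rhoTopology 𝔊; ∀ k h, IsOpen (Sm k h))
    (T : (k : ℕ) → GaugeField S.P 0 G → GaugeField S.P k G) (Bk : (k : ℕ) → Hist S.P k → Set (PBond S.P k))
    (hcont : letI := rhoTopology 𝔊; ∀ (k : ℕ) (h : Hist S.P k), ∀ j < k, ∀ (z : B7Prop1Explicit.Site S.P.d) (κ : Fin S.P.d),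
      projSite (((L : ℤ) ^ j) • z) ∈ Lam 𝔠.lane.carrier.M₁ (rcolOf S 𝔠.lane.carrier) h j →
      projSite (((L : ℤ) ^ j) • (z + e κ)) ∈ Lam 𝔠.lane.carrier.M₁ (rcolOf S 𝔠.lane.carrier) h j →
      ContinuousOn (fun U : GaugeField S.P 0 G => ((avgIter L (liftCfg 𝔊 U) j z κ : (Matrix (Fin 𝔊.N) (Fin 𝔊.N) ℂ)ˣ) :
        Matrix (Fin 𝔊.N) (Fin 𝔊.N) ℂ)) (regClass 𝔊 𝔠 k h))
    (hT : letI := rhoTopology 𝔊; ∀ (k : ℕ) (h : Hist S.P k), ContinuousOn (T k) (regClass 𝔊 𝔠 k h))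
    (hne : ∀ k, k ≤ S.K → ∀ (h : Hist S.P k), Hist.Admissible 𝔠.lane.carrier.M₁ (rcolOf S 𝔠.lane.carrier) k h →
      ∀ (V : GaugeField S.P k G), (admB42c 𝔊 𝔠 k h (Vl k h) (Sm k h) (T k) (Bk k h) V).Nonempty) :
    ∃ X : ExternalInputs S G, X.av = X₀.av ∧ X.reg = X₀.reg ∧
      (∀ (k : ℕ) (h : Hist S.P k), Measurable (X.UkH k h)) ∧
      (∀ k, k ≤ S.K → ∀ (h : Hist S.P k) (U : GaugeField S.P k G), ∀ j < k,
        RegLift S j (Omega 𝔠.lane.carrier.M₁ (rcolOf S 𝔠.lane.carrier) k h j)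
          (𝔠.C68 * (S.gk j * pFun 𝔠.lane.carrier.b₀ 𝔠.lane.carrier.p₀ (S.gk j))) (liftCfg 𝔊 (X.UkH k h U))) ∧
      (∀ k, k ≤ S.K → ∀ (h : Hist S.P k), Hist.Admissible 𝔠.lane.carrier.M₁ (rcolOf S 𝔠.lane.carrier) k h → h ≠ Hist.triv S.P k →
        ∀ (U : GaugeField S.P k G), X.UkH k h U ∈ admB42c 𝔊 𝔠 k h (Vl k h) (Sm k h) (T k) (Bk k h) U ∧
          IsMinOn A (admB42c 𝔊 𝔠 k h (Vl k h) (Sm k h) (T k) (Bk k h) U) (X.UkH k h U)) ∧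
      (∀ k, k + 1 ≤ S.K → Hist.Admissible 𝔠.lane.carrier.M₁ (rcolOf S 𝔠.lane.carrier) (k + 1) (Hist.triv S.P (k + 1)) →
        ∀ (U : GaugeField S.P (k + 1) G),
          X.Uk k U ∈ admB42c 𝔊 𝔠 (k + 1) (Hist.triv S.P (k + 1)) (Vl (k + 1) (Hist.triv S.P (k + 1))) (Sm (k + 1) (Hist.triv S.P (k + 1)))
              (T (k + 1)) (Bk (k + 1) (Hist.triv S.P (k + 1))) U ∧
            IsMinOn A (admB42c 𝔊 𝔠 (k + 1) (Hist.triv S.P (k + 1)) (Vl (k + 1) (Hist.triv S.P (k + 1))) (Sm (k + 1) (Hist.triv S.P (k + 1)))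
              (T (k + 1)) (Bk (k + 1) (Hist.triv S.P (k + 1))) U) (X.Uk k U)) ∧
      InEdgeFaces₃ 𝔊 𝔠 X := by
  obtain ⟨X, hav, hreg, hm, hmin, hminT, hout, houtT⟩ := exists_externalInputs_of_selectors X₀ A
    (fun k h V => admB42c 𝔊 𝔠 k h (Vl k h) (Sm k h) (T k) (Bk k h) V)
    (fun k h => (exists_selector_admB42c 𝔊 𝔠 k h (Vl k h) (hSm k h) (T k) (Bk k h) (hcont k h) (hT k h) hA).1)
  -- solvability from non-emptiness by compactness
  have hsolv : ∀ k, k ≤ S.K → ∀ (h : Hist S.P k), Hist.Admissible 𝔠.lane.carrier.M₁ (rcolOf S 𝔠.lane.carrier) k h →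
      ∀ (V : GaugeField S.P k G), ∃ U ∈ admB42c 𝔊 𝔠 k h (Vl k h) (Sm k h) (T k) (Bk k h) V,
        IsMinOn A (admB42c 𝔊 𝔠 k h (Vl k h) (Sm k h) (T k) (Bk k h) V) U :=
    fun k hk h hh V => (exists_selector_admB42c 𝔊 𝔠 k h (Vl k h) (hSm k h) (T k) (Bk k h) (hcont k h) (hT k h) hA).2 hk V
      (hne k hk h hh V)
  -- (ii) every value lies in the open regular class: a member of the constraint space (⊆ closed class ⊆ open class), or `1`
  have hval : ∀ k, k ≤ S.K → ∀ (h : Hist S.P k) (U : GaugeField S.P k G), X.UkH k h U ∈ regClass 𝔊 𝔠 k h := by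
    intro k hk h U
    by_cases hh : h = Hist.triv S.P k
    · subst hh
      rw [X.UkH_triv]
      cases k with
      | zero => exact fun j hj => absurd hj (Nat.not_lt_zero j)
      | succ k =>
        show X.Uk k U ∈ regClass 𝔊 𝔠 (k + 1) (Hist.triv S.P (k + 1))
        by_cases hex : ∃ U' ∈ admB42c 𝔊 𝔠 (k + 1) (Hist.triv S.P (k + 1)) (Vl (k + 1) (Hist.triv S.P (k + 1))) (Sm (k + 1) (Hist.triv S.P (k + 1)))
            (T (k + 1)) (Bk (k + 1) (Hist.triv S.P (k + 1))) U,
            IsMinOn A (admB42c 𝔊 𝔠 (k + 1) (Hist.triv S.P (k + 1)) (Vl (k + 1) (Hist.triv S.P (k + 1))) (Sm (k + 1) (Hist.triv S.P (k + 1)))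
              (T (k + 1)) (Bk (k + 1) (Hist.triv S.P (k + 1))) U) U'
        · exact (hminT k U hex).1.1.1
        · rw [houtT k U hex]
          exact one_mem_regClass 𝔊 𝔠 (k + 1) hk _
    · by_cases hex : ∃ U' ∈ admB42c 𝔊 𝔠 k h (Vl k h) (Sm k h) (T k) (Bk k h) U,
          IsMinOn A (admB42c 𝔊 𝔠 k h (Vl k h) (Sm k h) (T k) (Bk k h) U) U'
      · exact (hmin k h U hh hex).1.1.1
      · rw [hout k h U hh hex]
        exact one_mem_regClass 𝔊 𝔠 k hk h
  have hreg2 : ∀ k, k ≤ S.K → ∀ (h : Hist S.P k) (U : GaugeField S.P k G), ∀ j < k,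
      RegLift S j (Omega 𝔠.lane.carrier.M₁ (rcolOf S 𝔠.lane.carrier) k h j)
        (𝔠.C68 * (S.gk j * pFun 𝔠.lane.carrier.b₀ 𝔠.lane.carrier.p₀ (S.gk j))) (liftCfg 𝔊 (X.UkH k h U)) :=
    fun k hk h U j hj => hval k hk h U j hj
  have hsolN : ∀ k, k ≤ S.K → ∀ (h : Hist S.P k), Hist.Admissible 𝔠.lane.carrier.M₁ (rcolOf S 𝔠.lane.carrier) k h →
      h ≠ Hist.triv S.P k → ∀ (U : GaugeField S.P k G), X.UkH k h U ∈ admB42c 𝔊 𝔠 k h (Vl k h) (Sm k h) (T k) (Bk k h) U ∧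
        IsMinOn A (admB42c 𝔊 𝔠 k h (Vl k h) (Sm k h) (T k) (Bk k h) U) (X.UkH k h U) :=
    fun k hk h hh ht U => hmin k h U ht (hsolv k hk h hh U)
  have hsolT : ∀ k, k + 1 ≤ S.K → Hist.Admissible 𝔠.lane.carrier.M₁ (rcolOf S 𝔠.lane.carrier) (k + 1) (Hist.triv S.P (k + 1)) →
      ∀ (U : GaugeField S.P (k + 1) G),
        X.Uk k U ∈ admB42c 𝔊 𝔠 (k + 1) (Hist.triv S.P (k + 1)) (Vl (k + 1) (Hist.triv S.P (k + 1))) (Sm (k + 1) (Hist.triv S.P (k + 1)))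
            (T (k + 1)) (Bk (k + 1) (Hist.triv S.P (k + 1))) U ∧
          IsMinOn A (admB42c 𝔊 𝔠 (k + 1) (Hist.triv S.P (k + 1)) (Vl (k + 1) (Hist.triv S.P (k + 1))) (Sm (k + 1) (Hist.triv S.P (k + 1)))
            (T (k + 1)) (Bk (k + 1) (Hist.triv S.P (k + 1))) U) (X.Uk k U) :=
    fun k hk hh U => hminT k U (hsolv (k + 1) hk _ hh U)
  have h42 : ∀ k, k ≤ S.K → ∀ (h : Hist S.P k), Hist.Admissible 𝔠.lane.carrier.M₁ (rcolOf S 𝔠.lane.carrier) k h →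
      ∀ (U : GaugeField S.P k G), ∃ V : ℕ → B7Prop1Explicit.Site S.P.d → Fin S.P.d → (Matrix (Fin 𝔊.N) (Fin 𝔊.N) ℂ)ˣ,
        HLarge S 𝔠.lane.carrier.b₀ 𝔠.lane.carrier.p₀ h V ∧
          InB42Lift S 𝔠.lane.carrier.M₁ (rcolOf S 𝔠.lane.carrier) h (liftCfg 𝔊 (X.UkH k h U)) V := by
    intro k hk h hh U
    refine ⟨Vl k h, hVl k h, ?_⟩
    by_cases ht : h = Hist.triv S.P k
    · subst ht
      cases k with
      | zero => exact fun j hj => absurd hj (Nat.not_lt_zero j)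
      | succ k =>
        rw [X.UkH_triv]
        exact (hsolT k hk hh U).1.1.2.1
    · exact (hsolN k hk h hh ht U).1.1.2.1
  exact ⟨X, hav, hreg, hm, hreg2, hsolN, hsolT, inEdgeFaces₃_of_inB42 𝔊 𝔠 X hm hreg2 h42⟩
end Faces
end Summit.QuantumFields.YangMills.Theorems.BalabanUVNodesN08AlphaCompactSel

end
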